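import Mathlib
import HarnessLib
import Summits.AtomisticToContinuum.Crystallization.Theorems.OverbindingBudgetLiouvilleDictionary
import Summits.AtomisticToContinuum.Crystallization.Theorems.ChartedPlanarOrderDoorLayeredExactness
import Summits.AtomisticToContinuum.Crystallization.Theorems.ChartedPlanarOrderDoorLayeredOsc

/-!
# «LatticeLiouville» — the LINEAR statics Liouville theorem of the harmonic Lennard-Jones (multi)lattice,
# beneath lens-3's L1′ (`DoorHomogeneityBD` / `DoorPeriodic`, tree `…ChartedPlanarOrderDoorLayered`) on N = `ChartedPlanarOrder.ChartedZeroExcessLayered` (stmt-26636)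
# (decomp-a2c lens-2 «structural dichotomy (special vs generic)», generation 23; critic ORDER row 387 (3), refined row 390 (1)(b)/(3);
# v8 = generation 24, critic rows 433 (B) / 434 (2): §A bounded special fibre `GammaKernelBdd` + layer-local currency, §C‴ registration literal
# θ = 1/16 / κ = 1/64, §D «LayeredLiouville» — the APERIODIC-stacking (layered) side and the split of the declared residual P ⟸ P♭ ∧ L_lay;
# v9 = generation 25 (parts G/H of the landing chain): §E «FlatnessHalving» — P♭ ⟸ E ∧ Z with the exact endgame Z PROVED and E ⟸ H PROVED, so the
# declared residual shrinks to the ONE-STEP ε-regularity H; §W the `_16dW` column at the widened pattern scale 103/100 (critic row 444 (A2));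
# v9 also rebases on / cites the tree twins flagged by hand-2 g9's dry-run and carries a docstring on every declaration;
# namespace = module path `…Theorems.ChartedZeroExcessLayeredLatticeLiouville` (row 433 caveat: lands under Theorems/, supersedes v7 127aec4a))

## The piece and why it is cut here

Beneath N the residual of record is `MuEquilibriumDoor ∧ [BULK|door ∨ (HBG♮′ ∧ RED♮′ ⟸ L1′ ∧ T′) ∨ R⋆]` (critic rows 387–389).
L1′ = lens-3's door homogeneity (g21 `DoorHomogeneity` over `NearHom`; of record since row 399 (8): `DoorHomogeneityBD 2`, tree `…DoorLayered`):
every rooted, separated, CLEAN, single-site NASH, Barlow-bond-CHARTED configuration is, at every scale `r` and every tolerance `τ`,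
near ONE homogeneously deformed layered structure `LayeredHom L w` — «door sets are rigid motions of `LayeredHom L w_eq`» (row 390
(4)(iii)).  AS TYPED over the tree's `NearHom` it is VACUOUSLY TRUE (lens-4 28, STATUS l.1888; critic ERRATUM row 399 (1)); §C below
types it over the bounded-distortion currency OF RECORD — lens-4's tree `OverbindingBudgetLiouvilleDictionary.NearHomBD Λ` (row 399 (2):
`L : E3 ≃L E3`, `‖L‖ ≤ Λ ∧ ‖L⁻¹‖ ≤ Λ`, Λ₀ = 2; non-vacuity `not_nearHomBD_singleton` in the tree, two-patch witness in the sibling node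
`HomCoercivityBD.lean` §5) as `DoorHomogeneityBD Λ`, and hangs the skeleton there (v1–v3 of this node carried a private currency; withdrawn
per row 399 (2)).  Its proof schema of
record (lens-3 MEMO-Liouville 336a99d5, critic row 390 (1)) is Campanato-from-infinity: compactness + linearisation at a clean stable
crystal + a LIOUVILLE THEOREM FOR THE LINEARISED (harmonic-lattice) EQUILIBRIUM EQUATIONS + small-strain ε-regularity constants
(census TAG 138′/139′).  Critic row 387 (3) commissions from lens-2 exactly the linear kernel:

  LinLiouville := «every bounded-strain solution of the linearised equilibrium equations on the perfect (inner-relaxed, periodic)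
  stacking is affine + the per-layer rigid translation modes that the dynamical matrix actually admits», Fourier-side kernel PROVED
  modulo ONE census certificate (FULL-Brillouin-zone phonon positivity, TAG 138′ (i′)), plus the skeleton L1′ ⟸ LinLiouville ∧ ε-regularity.

## The lens: SPECIAL (Γ-point, k = 0) ∣ GENERIC (k ≠ 0) Fourier support

A bounded-gradient harmonic field `u` on the multilattice `ℤᵈ × ι` has, on the Fourier side, a distributional transform supported
where the dynamical matrix `K̂(k)` is singular.  Phonon positivity away from `Γ` (acoustic branches `≥ c|k|²`, optical `≥ c`) empties
the GENERIC fibre `k ≠ 0`; what remains is the SPECIAL fibre `k = 0`, a FINITE-DIMENSIONAL linear-algebra statement about the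
`3|ι| × 3|ι|` matrix `K̂(0)` (which sublattice-wise rigid translations are force-free).  In lattice language, with NO Fourier analysis
in the statements:

* GENERIC piece  `BoundedFlat K`  — every BOUNDED harmonic field is cell-independent (`u γ α = v α`).      [k ≠ 0 emptied + acoustic Γ]
* SPECIAL piece  `GammaKernel K`  — every cell-independent harmonic field is a uniform translation (`v α = v β`).  [optical Γ-modes stiff]
* TARGET         `LinLiouville K` — every harmonic field of bounded discrete gradient is AFFINE with ONE macroscopic gradient common to
                                     all sublattices plus sublattice constants (= the tangent of `LayeredHom` with ONE `L`: inner
                                     displacement and per-layer registry sit in the constants `c α`).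

KERNEL (PROVED, pure algebra — translation invariance + linearity + «constant increments along every axis ⇒ affine»):
  `linLiouvilleModal_of_boundedFlat`   : BoundedFlat K → LinLiouvilleModal K      (affine with Γ-MODE-valued gradients: EXACTLY the
                                                                                    critic's «affine + rigid layer modes the dynamical
                                                                                    matrix admits»; and conversely
  `boundedFlat_of_linLiouvilleModal`   : LinLiouvilleModal K → BoundedFlat K       — the generic piece IS the modal Liouville theorem)
  `linLiouville_of_modal`              : LinLiouvilleModal K → GammaKernel K → LinLiouville K
  `boundedFlat_of_linLiouville`        : LinLiouville K → BoundedFlat K            (generic piece WEAKER than the target, certified)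
  `gammaKernel_of_subsingleton`        : GammaKernel K for Bravais lattices (|ι| ≤ 1: fcc) — the special piece's first rung, PROVED,
  `linLiouville_of_boundedFlat_bravais`: so for fcc the target IS the generic piece.

ANALYTIC REDUCTION (typed, NOT proved here — ATTACKABLE·M/L, folklore shape): `DecayFromCoercivity K` :=
  Symm K → SelfAdj K → Moment₂ K → (∃ κ > 0, Coercive K κ) → BoundedFlat K ∧ GammaKernel K
(action–reaction symmetry AND blockwise self-adjointness, both PROVED for the LJ kernel: `ljKernel_symm`, `ljKernel_selfAdj`)
by TWO discrete Caccioppoli steps (test the equation against χ²u; the infinite range costs the SECOND MOMENT Σ‖K(δ)‖|δ|² of the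
force constants, finite for the r⁻⁸ Lennard-Jones bond Hessians in d = 3): Σ_{Q_R}|∇u|² ≤ C R^{d−2}·sup|u|², then for the harmonic
difference field w = ∇ₑu: Σ_{Q_R}|∇w|² ≤ C R^{d−4} → 0 (d ≤ 3; ⌈d/2⌉ steps in general) ⇒ ∇w ≡ 0 across cells AND sublattices ⇒ u affine
with a common gradient, bounded ⇒ cell-constant (BoundedFlat); one sharp-cutoff step R³|Δv|² ≤ C R² M₁|v|² gives GammaKernel.
[corpus: giaquinta1984 III pp.64–66, 136 (Campanato/Caccioppoli for systems); Kuchment–Pinchover, Liouville theorems on periodic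
graphs/abelian covers (polynomial-growth solutions ⇔ Fermi surface {0}; dimension count) — cite-level support of record, critic row 390 (1)(b)]
[tree analogue: the NONLINEAR bounded-displacement blow-down for the hcp two-lattice, `Theorems.ExcessDecayLiouvilleHcpLiouville*`
(`hcpLiouville_of_ownSecant`: Caccioppoli → Green → interior decay → improvement → iteration, all landed modulo two certificates)].

CENSUS CERTIFICATE (INSTRUMENTABLE = TAG 138′ (i′) «full-BZ phonon positivity, acoustic scaled by |k|², optical incl. Γ»):
`Coercive (ljKernel A m) κ` — κ·(index nearest-neighbour strain form) ≤ ½·(second variation) on finitely supported test fields of the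
periodic multilattice `(A, m)`; by Plancherel it is EQUIVALENT to `K̂(k) ≥ c(|k|² ⊕ 1)` blockwise on acoustic ⊕ optical (the tree's
`PricedLinkCensus…HarmonicBlochPositivity.blockConvForm_nonneg_of_symbol_real` is the finite-torus model of this dictionary); its hcp
instance on the (0.97 ± 1/40)-window is, up to the comparison of the index nn-form with the geometric 11/10-bond nn-form, the route
crux `ExcessDecayLiouville.PhononStability` (stmt-AtomisticToContinuum-9333) — DEDUP HOOK, not restated.  STABLE-SUB-WINDOW CAVEAT
(critic row 390 (3)): the certificate is typed PER GEOMETRY (`CrystalStable A m`); if TAG 138′ finds symbol ≤ 0 samples inside the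
(1/16, 9/10, 1)-clean window, `CleanCrystalStability` is to be RESTRICTED to the stable sub-window, and with it L1′ — not abandoned.
Stability is also NECESSARY for the target: a soft mode `K̂(k₀)v = 0`, `k₀ ≠ 0`, is a bounded non-constant harmonic field, so
`¬BoundedFlat`, so `¬LinLiouville` (`boundedFlat_of_linLiouville`) — the piece is killable by the same census.

## Ledger of pieces (tags per cell protocol)

  T  `LatticeLinLiouville`    TARGET of this node (theorem-shaped, census-free: stable separated LJ multilattices satisfy LinLiouville)
     ⟸ `LJDecay` [ATTACKABLE·M/L, the two Caccioppoli steps, abstractly `DecayFromCoercivity`] ∧ `LJMoments` [ATTACKABLE·S/M: r⁻⁸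
     bond-Hessian decay `norm_forceConst_le` summed over a separated set] — `latticeLinLiouville_of` PROVED (symmetry of the LJ kernel
     `ljKernel_symm` PROVED in-node);
  G  `BoundedFlat`            GENERIC · WEAKER than T (`boundedFlat_of_linLiouville`) · EQUIVALENT to the modal target · ATTACKABLE;
  Γ  `GammaKernel`            SPECIAL · finite-dimensional (3|ι| × 3|ι| linear algebra on the force constants: decidable given the
                              numbers) · NOT implied by T as typed (T leaves the sublattice constants free) · implied by Coercive ·
                              PROVED for Bravais lattices · INSTRUMENTABLE (Γ-optical column of TAG 138′ (i′));
  C  `CleanCrystalStability`  CENSUS CERTIFICATE · INSTRUMENTABLE (TAG 138′ (i′)) · stable-sub-window caveat;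
  L  `LatticeLiouvilleCert`   = what lens-3's transfer consumes: clean ∧ Nash periodic LJ crystals satisfy LinLiouville
     ⟸ T ∧ C (`latticeLiouvilleCert_of`, PROVED);
  N′ `NonlinearTransfer Λ`    := L → L1′(Λ) · UNDECIDED · BRIDGE-SHAPED — the content of L1′ (discrete rigidity K_A² + excess-decay
                              K_B² with TAG 138′/139′ constants; Nash-ESSENTIAL by the F. John spiral, rows 390 (1)(a), 395 (2)) lives
                              HERE and is OWNED BY LENS-3 (row 387 (3): «lens-3 owns L1′, lens-2 owns the linear kernel»); this node claims
                              NO reduction of L1′ beyond `doorHomogeneityBD_of : L → N′(Λ) → L1′(Λ)` and `doorHomogeneity_of_BD`;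
  L1′(Λ) `DoorHomogeneityBD Λ` the REPAIRED L1′ over the TREE currency `NearHomBD Λ` (lens-4; row 399 (2)(8): L1′_BD := DoorHomogeneityBD 2),
                              VERBATIM the sibling node's `HomCoercivityBD.DoorHomogeneityBD` (one item by normalised signature);
                              `doorHomogeneity_of_BD` = refines the tree reading (tree `nearHom_of_nearHomBD`), PROVED.
  N″ `NonlinearTransferExact Λ` := L → L1′♮(Λ) `DoorPeriodic Λ` (chart-free EXACT reading, VERBATIM lens-3 §3d over the tree's `TwoPeriodic`;
                              §C′, v5, critic l.1957 ORDER) · UNDECIDED · BRIDGE-SHAPED · WEAKER than N′ given lens-3 §3d;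
                              `doorPeriodic_of_pieces : LJDecay → LJMoments → CleanCrystalStability → N″ 2 → DoorPeriodic 2` PROVED.
  N″(Λ, θ) `NonlinearTransferOsc Λ θ` := L → `DoorPeriodicOsc Λ θ` (the transfer WITH AN EXPLICIT OSCILLATION PARAMETER, critic row 414 (1)(d)
                              ★ PERTURBATIVE-WINDOW FLAG / standing assignment row 416 (4); §C″, v7; ONE CURRENCY = lens-3 g22's TREE module
                              `…ChartedPlanarOrderDoorLayeredOsc`: `DoorPeriodicOsc`, `OscillationImprovement`, seam `doorPeriodic_of_osc`) ·
                              UNDECIDED · BRIDGE-SHAPED · WEAKER than N″ (`nonlinearTransferOsc_of_exact`), anti-monotone in θ, and ⟺ N″ for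
                              θ ≥ 1/16 (`nonlinearTransferOsc_iff_exact_of_ge`, bootstrap free); literal of record θ_osc = 1/32 (fcc CAMP window);
                              ★ `gap_and_pert_1_50_of_liouville_pieces_osc : LJDecay → LJMoments → CleanCrystalStability → N″(2, θ) →
                              OscillationImprovement θ → PeriodicBulkGapDoor 2 → VisibleGap (1/50) ∧ PertRegime (1/50)` PROVED (six typed leaves).
  R/P (§C‴, v7)               the two typed halves of N″(Λ, θ) over lens-3's tree L²-currency `NearHomL2BD` / K_A²_BD / K_B²♮: R `OscRigidityL2BD Λ θ κ`
                              (multiscale rigidity, energy- and equation-free, FREE for κ ≥ 16) and P `LinearisedFlatnessExact Λ θ κ` (certificate-fed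
                              perturbative excess decay ⇒ exact two-periodicity); `nonlinearTransferOsc_of_L2 : R → P → N″(Λ, θ)` PROVED; lens-3's
                              K_A²_BD / K_B²♮ give R / P by dropping hypotheses (PROVED); literal κ(θ) = 4θ² (KORN C_rig ≈ 2): (1/32, 1/256);
                              ★ `gap_and_pert_1_50_of_liouville_pieces_L2` = the perturbative (β) column from SEVEN Liouville-side leaves + HBG″.

  v8 (generation 24):
  Γ♭ `GammaKernelBdd`        SPECIAL piece in BOUNDED form (§A) — the right special fibre for an infinite index set; the exhaustion
                             `linLiouville_of_boundedFlat_of_gammaKernelBdd` PROVED; layer-local energy currency `nnFormZ` / `CoerciveZ` / `Moment₂Z` /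
                             `DecayFromCoercivityZ` (ATTACKABLE·M/L) for index set `ℤ`;
  T_lay `LayeredLinLiouville` (§D) TARGET of the layered side: co-Lipschitz, STABLE LJ layered structures `Layered a b w` — ANY stacking word —
                             satisfy LinLiouville (ONE in-plane gradient + FREE per-layer constants = the tangent of the chart family);
                             ⟸ `LayeredDecay` [ATTACKABLE·M/L, structure-free] ∧ `LayeredMoments` [TRUE-type·S/M] (`layeredLinLiouville_of`, with
                             `layeredKernel_symm` / `layeredKernel_selfAdj` PROVED); ⟸ G_lay `LayeredBoundedFlat` ∧ Γ_lay^bdd `LayeredGammaKernelBdd`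
                             (`layeredLinLiouville_of_pieces`, the lens cut one level down, PROVED; G_lay WEAKER, `layeredBoundedFlat_of`);
  C_lay `LayeredCrystalStability` LAYERED CENSUS CERTIFICATE · INSTRUMENTABLE (POLYTYPE-BLOCH + CHAIN-MARGIN columns) · per structure;
  L_lay `LayeredLiouvilleCert` = what P's aperiodic linearisation consumes ⟸ T_lay ∧ C_lay (`layeredLiouvilleCert_of`, PROVED);
  P♭ `LinearisedFlatnessLayered Λ θ κ` (§D′) := LatticeLiouvilleCert → LayeredLiouvilleCert → (P's binders) → TwoPeriodic Λ S — P with gap (a) made a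
                             hypothesis · WEAKER than P · UNDECIDED · DECLARED-RESIDUAL of g24 (nonlinear ε-regularity + iteration down the scales);
                             ★ P ⟸ P♭ ∧ L_lay (`linearisedFlatnessExact_of_layered`) and P ⟸ P♭ ∧ LayeredDecay ∧ LayeredMoments ∧ C_lay
                             (`linearisedFlatnessExact_of_layered_pieces`) PROVED; ★ `gap_and_pert_1_50_of_layered_pieces_16` = the (β) column at the
                             REGISTRATION literals (2, 1/16, 1/64) from eight typed Liouville-side leaves + HBG″, `gap_and_pert_1_50_of_certs_16` = the same
                             in five leaves, `_32` = the fallback literal with the bootstrap; §C‴ gains `gap_and_pert_1_50_of_liouville_pieces_L2_16`.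
  (v9, part G) Z `ExactEndgame Λ` — the target ON THE SPECIAL CLASS `AsymptoticallyLayerFlat Λ S` (misfit → 0 on every far root window ⇒ exactly
                             two-periodic) · ★ PROVED for every `Λ ≤ 4` (`exactEndgame_of_le`: windowed form of lens-3's tree exactness theorem +
                             pigeonhole on root neighbours);
  E  `FlatnessExtinction Λ θ κ` = P♭ with conclusion weakened to `AsymptoticallyLayerFlat` (GENERIC class empty) · UNDECIDED · ≡ P♭ in substance ·
                             ★ P♭ ⟸ E ∧ Z and E ⟸ H PROVED (`linearisedFlatnessLayered_of_extinction_endgame`, `flatnessExtinction_of_halving`);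
  H  `FlatnessHalving Λ θ κ` — the ONE-STEP nonlinear ε-regularity (flat(η) on B(0,M·R) ⇒ flat(η/2) on B(0,R), every level η ≤ κ, R ≥ R₀, given both
                             certificates) · STRONGER than P♭ by design (a rate) · UNDECIDED · TRUE-type · DECLARED-RESIDUAL of g25;
                             ★ `linearisedFlatnessLayered_of_halving` (P♭ ⟸ H alone, `Λ ≤ 4`), columns `gap_and_pert_1_50_of_certs_16h` /
                             `_layered_pieces_16h` (H replaces P♭ leafwise), optimistic `_certs_16H` (H from the rigidity level: D and P♭ both absorbed);
  (v9, part H) R_W / D_W / P♭_W / H_W — the same pieces over lens-3's `IsDoorSetP (103/100)` door sets (= lens-4's `IsDoorSetW`), θ_W = 103/1600 ·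
                             leafwise STRONGER than the v8 pieces (`.anti`, `_one_iff`) · ★ `gap_and_pert_1_50_of_certs_16dW` / `_16hW` and
                             `doorPeriodicW_of_certs_16dW : … → DoorPeriodicP 2 (103/100)` (lens-4's THIRTEENTH-cone slot `DoorPeriodicW 2`, `Iff.rfl`).

WHY NOVEL (tree-relative): the tree's Liouville objects are (i) `ExcessDecayLiouville.HcpLiouville` 9332 — NONLINEAR, bounded
DISPLACEMENT (global 1/40-matching with ONE datum), hcp only; (ii) lens-3's `LayerChainLiouville` (1D profile chains, k∥ = 0 only);
(iii) `DisclinationRation.BarlowLiouville` 15801 — energetic kissing rigidity, unrelated.  Nothing in the tree states the bounded-GRADIENT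
(linear-growth) Liouville for a general periodic multilattice, nor isolates its Γ-point content `GammaKernel` as the finite-dimensional
special fibre; `lean search 'GammaKernel|BoundedFlat|LinLiouville|IsModalAffine'` → no hits (2026-08-31).  (v8) Nor does anything in the tree or in
print state a linear statics Liouville theorem for an APERIODIC stacking (a discrete LAMINATE): lens-3's E1 is the k∥ = 0 chain only; the continuum
counterpart — elliptic systems with coefficients depending on ONE variable have interior gradient estimates — is [galaxy:pdf:7850702777381559100]
(Li–Nirenberg 2003; Chipot–Kinderlehrer–Vergara-Caffarelli 1986, cite-level); `lean search 'layeredKernel|LayeredLinLiouville|GammaKernelBdd|CoerciveZ|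
LinearisedFlatnessLayered'` → no hits; galaxy pdf "Liouville theorem for discrete|stacking fault|polytype phonon" → nothing relevant (2026-08-31).
(v9) The tree's exactness-by-discreteness theorem `twoPeriodic_of_forall_nearHomBD` (lens-3, …DoorLayeredExactness) is GLOBAL (one chart for all of
S at every tolerance); Z is its WINDOWED form (per-window charts, L² → sup at finite windows, pigeonhole gluing of window periods) and H / E type the
excess-decay ITERATION (Schoen–Uhlenbeck / Campanato shape) for point configurations in the misfit currency `NearHomL2BD` — `lean search
'FlatnessHalving|AsymptoticallyLayerFlat|ExactEndgame|FlatnessExtinction'` → no hits (2026-08-31); corpus / galaxy queries in the g25 NODE card.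

WHY EACH PIECE IS (OR IS NOT) STRICTLY WEAKER: G ⟸ T proved; G ⇏ T for |ι| ≥ 2 by cheap means (probe MUST-FAIL; mathematically G gives
only Γ-mode-valued gradients); Γ is a finite-dimensional side certificate, incomparable with T as typed (honest: NOT weaker); C is a
numerical certificate about finitely supported test fields, incomparable with T; N′ is a bridge (T-side open ∧ substantive).
(v8) P ⟹ P♭ proved, P♭ ⇏ P by cheap means (probe MUST-FAIL: the layered certificate is substantive); T_lay / C_lay / L_lay are statements about
EXACT layered structures, incomparable with P, N″ and N (statements about door sets); G_lay ⟸ T_lay proved, Γ_lay^bdd incomparable (honest).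
(v9) E ⟹ P♭ proved (through Z); P♭ ⟹ E only structurally (given exact periods are a chart, possibly ill-conditioned — not typed); H ⟹ E ⟹ P♭ proved,
H STRONGER than P♭ by design (a RATE at every level; P♭ is silent unless all windows are κ-flat) — a declared TRANSFER, easier because ONE scale ratio;
Z is a THEOREM (no tag); the W-pieces are leafwise STRONGER than the v8 pieces (more door sets) and incomparable with N as typed.
-/

noncomputable section

open scoped BigOperators InnerProductSpace RealInnerProductSpace
open MeasureTheory Set Metric
open Summit.AtomisticToContinuum.Crystallization.Theorems.ChartedPlanarOrderRigidityDoor (E3 IsClean IsNash IsCharted VisibleGap PertRegime atomsIn)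
open Summit.AtomisticToContinuum.Crystallization.Theorems.ChartedPlanarOrderDensityDichotomy (μS IsSep)
open Summit.AtomisticToContinuum.Crystallization.Theorems.ChartedPlanarOrderMesoCut (IsDoorSet NearHom LayeredHom EnvClose)
open Summit.AtomisticToContinuum.Crystallization.Theorems.OverbindingBudgetLiouvilleDictionary (NearHomBD nearHom_of_nearHomBD)
open Summit.AtomisticToContinuum.Crystallization.Theorems.ChartedPlanarOrderDoorLayered
  (TwoPeriodic not_twoPeriodic_singleton DoorHomogeneityBD DoorPeriodic PeriodicBulkGapDoor PeriodicBulkGap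
   doorPeriodic_of_doorHomogeneityBD gap_and_pert_1_50_of_periodic gap_and_pert_1_50_of_periodic'
   NearHomL2BD CleanScaleCoherenceL2BD FlatnessExactL2BD doorPeriodic_of_L2 cleanScaleCoherenceL2BD_of_large nearHomL2BD_mono Layered)
open Summit.AtomisticToContinuum.Crystallization.Theorems.ChartedPlanarOrderDoorLayeredOsc
  (IsTwoShellAffineGood OscillationImprovement DoorPeriodicOsc doorPeriodic_of_osc doorPeriodicOsc_of_doorPeriodic
   oscillationImprovement_of_ge)
open Literature.MathematicalPhysics.StatisticalMechanics (triangularVec₁ triangularVec₂)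

namespace Summit.AtomisticToContinuum.Crystallization.Theorems.ChartedZeroExcessLayeredLatticeLiouville

/-! ## §A  The abstract harmonic multilattice `ℤᵈ × ι` with operator-valued force constants -/

/-- cells of the Bravais lattice `ℤᵈ` (sup metric). -/
abbrev Cell (d : ℕ) := Fin d → ℤ

section Abstract

variable {d : ℕ} {ι : Type*} {V : Type*} [NormedAddCommGroup V] [InnerProductSpace ℝ V]

/-- **Linearised equilibrium (force balance)**: `K δ α β : V →L[ℝ] V` couples site `(γ, α)` to site `(γ + δ, β)`;
`u` is HARMONIC iff at every site `Σ_{(δ,β)} K δ α β (u (γ+δ) β − u γ α) = 0` as an (unconditionally convergent) `HasSum`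
— the `(0, α)` term is `0`, and a non-summable row cannot satisfy it (no junk value). -/
def IsHarmonic (K : Cell d → ι → ι → (V →L[ℝ] V)) (u : Cell d → ι → V) : Prop :=
  ∀ (γ : Cell d) (α : ι), HasSum (fun x : Cell d × ι => K x.1 α x.2 (u (γ + x.1) x.2 - u γ α)) 0

/-- bounded displacement. -/
def IsBdd (u : Cell d → ι → V) : Prop := ∃ C : ℝ, ∀ γ α, ‖u γ α‖ ≤ C

/-- **bounded discrete gradient** («bounded strain AND rotation», lens-3 memo §3): all difference quotients bounded,
across cells and sublattices. -/
def BoundedGradient (u : Cell d → ι → V) : Prop :=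
  ∃ C : ℝ, ∀ (γ γ' : Cell d) (α β : ι), ‖u γ' β - u γ α‖ ≤ C * (dist γ γ' + 1)

/-- AFFINE with ONE macroscopic gradient `a` common to all sublattices, plus sublattice constants `c α`
(inner displacement / per-layer registry / translation). -/
def IsAffine (u : Cell d → ι → V) : Prop :=
  ∃ (a : Fin d → V) (c : ι → V), ∀ γ α, u γ α = (∑ j, (γ j : ℝ) • a j) + c α

/-- a Γ-MODE: a cell-independent field `(γ, α) ↦ v α` that is harmonic (a force-free pattern of sublattice-wise rigid
translations — «rigid layer modes the dynamical matrix admits»). -/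
def IsGammaMode (K : Cell d → ι → ι → (V →L[ℝ] V)) (v : ι → V) : Prop :=
  IsHarmonic K (fun _ α => v α)

/-- MODAL-AFFINE: affine with Γ-mode-valued directional gradients `a j : ι → V` plus sublattice constants. -/
def IsModalAffine (K : Cell d → ι → ι → (V →L[ℝ] V)) (u : Cell d → ι → V) : Prop :=
  ∃ (a : Fin d → ι → V) (c : ι → V), (∀ j, IsGammaMode K (a j)) ∧ ∀ γ α, u γ α = (∑ j, (γ j : ℝ) • a j α) + c α

/-- **TARGET `LinLiouville K`** — the linear statics Liouville theorem: harmonic ∧ bounded discrete gradient ⇒ affine with a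
common gradient. -/
def LinLiouville (K : Cell d → ι → ι → (V →L[ℝ] V)) : Prop :=
  ∀ u : Cell d → ι → V, IsHarmonic K u → BoundedGradient u → IsAffine u

/-- the MODAL target: harmonic ∧ bounded gradient ⇒ modal-affine (critic row 387 (3) verbatim: «affine + per-layer rigid translation
modes that the dynamical matrix actually admits»). -/
def LinLiouvilleModal (K : Cell d → ι → ι → (V →L[ℝ] V)) : Prop :=
  ∀ u : Cell d → ι → V, IsHarmonic K u → BoundedGradient u → IsModalAffine K u

/-- **GENERIC piece `BoundedFlat K`** (k ≠ 0 fibre empty + acoustic Γ): every BOUNDED harmonic field is cell-independent. -/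
def BoundedFlat (K : Cell d → ι → ι → (V →L[ℝ] V)) : Prop :=
  ∀ u : Cell d → ι → V, IsHarmonic K u → IsBdd u → ∃ v : ι → V, ∀ γ α, u γ α = v α

/-- **SPECIAL piece `GammaKernel K`** (k = 0 fibre, optical Γ-modes stiff): the only Γ-modes are uniform translations. -/
def GammaKernel (K : Cell d → ι → ι → (V →L[ℝ] V)) : Prop :=
  ∀ v : ι → V, IsGammaMode K v → ∀ α β, v α = v β

/-! ### energy side: the coercivity certificate, moments, symmetry, and the analytic reduction (typed) -/

/-- finitely supported test fields. -/
def HasFiniteSupport (φ : Cell d → ι → V) : Prop :=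
  ∃ s : Finset (Cell d × ι), ∀ γ α, (γ, α) ∉ s → φ γ α = 0

/-- index nearest-neighbour strain form `Σ_{(p,q) : dist p.cell q.cell ≤ 1} ‖φ q − φ p‖²` (a `finsum`; finite for finitely supported `φ`). -/
def nnForm (φ : Cell d → ι → V) : ℝ :=
  ∑ᶠ x : (Cell d × ι) × (Cell d × ι), if dist x.1.1 x.2.1 ≤ 1 then ‖φ x.2.1 x.2.2 - φ x.1.1 x.1.2‖ ^ 2 else 0

/-- **CERTIFICATE `Coercive K κ`** (harmonic = phonon stability, acoustic AND optical, in lattice form; shape of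
`ExcessDecayLiouville.PhononStability`): `κ · nnForm φ ≤ ½ Σ_{p,q} ⟪φ q − φ p, K(q − p)(φ q − φ p)⟫` for every finitely supported `φ`
(the second variation entered as a `HasSum` value — no junk). -/
def Coercive (K : Cell d → ι → ι → (V →L[ℝ] V)) (κ : ℝ) : Prop :=
  ∀ φ : Cell d → ι → V, HasFiniteSupport φ → ∀ E : ℝ,
    HasSum (fun x : (Cell d × ι) × (Cell d × ι) =>
      ⟪φ x.2.1 x.2.2 - φ x.1.1 x.1.2, K (x.2.1 - x.1.1) x.1.2 x.2.2 (φ x.2.1 x.2.2 - φ x.1.1 x.1.2)⟫) E →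
    κ * nnForm φ ≤ E / 2

/-- second moment of the force constants, row-wise: `Σ_{(δ,β)} ‖K δ α β‖ (‖δ‖ + 1)² < ∞`. -/
def Moment₂ (K : Cell d → ι → ι → (V →L[ℝ] V)) : Prop :=
  ∀ α, Summable fun x : Cell d × ι => ‖K x.1 α x.2‖ * (‖x.1‖ + 1) ^ 2

/-- action–reaction symmetry `K(−δ) β α = (K δ α β)ᵀ`. -/
def Symm (K : Cell d → ι → ι → (V →L[ℝ] V)) : Prop :=
  ∀ δ α β (x y : V), ⟪K δ α β x, y⟫ = ⟪x, K (-δ) β α y⟫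

/-- blockwise self-adjointness `K δ α β = (K δ α β)ᵀ` (pair potentials: each bond's force constant is a symmetric 3×3 block; needed so
that the quadratic form of `Coercive` and the equilibrium equations of `IsHarmonic` see the SAME operator). -/
def SelfAdj (K : Cell d → ι → ι → (V →L[ℝ] V)) : Prop :=
  ∀ δ α β (x y : V), ⟪K δ α β x, y⟫ = ⟪x, K δ α β y⟫

/-- **ANALYTIC REDUCTION `DecayFromCoercivity K`** (ATTACKABLE·M/L; two discrete Caccioppoli steps + one sharp-cutoff step, see the
module docstring): symmetric, second-moment force constants with the coercivity certificate have BOTH fibres empty. -/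
def DecayFromCoercivity (K : Cell d → ι → ι → (V →L[ℝ] V)) : Prop :=
  Symm K → SelfAdj K → Moment₂ K → (∃ κ : ℝ, 0 < κ ∧ Coercive K κ) → BoundedFlat K ∧ GammaKernel K

/-! ### elementary calculus of harmonic fields -/

/-- harmonic fields form a subgroup: the difference of two `K`-harmonic fields is `K`-harmonic (linearity of the force constants). [folklore] -/
theorem IsHarmonic.sub {K : Cell d → ι → ι → (V →L[ℝ] V)} {u u' : Cell d → ι → V}
    (hu : IsHarmonic K u) (hu' : IsHarmonic K u') : IsHarmonic K (fun γ α => u γ α - u' γ α) := by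
  intro γ α
  have h := (hu γ α).sub (hu' γ α)
  rw [sub_zero] at h
  refine h.congr_fun fun x => ?_
  simp only [← map_sub]
  congr 1
  abel

/-- translation invariance: a cell-shift `u (· + e)` of a `K`-harmonic field is `K`-harmonic. [folklore] -/
theorem IsHarmonic.shift {K : Cell d → ι → ι → (V →L[ℝ] V)} {u : Cell d → ι → V}
    (hu : IsHarmonic K u) (e : Cell d) : IsHarmonic K (fun γ α => u (γ + e) α) := by
  intro γ α
  refine (hu (γ + e) α).congr_fun fun x => ?_
  simp only [add_right_comm γ e x.1]

/-- harmonicity is invariant under pointwise equality of fields. [folklore] -/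
theorem isHarmonic_congr {K : Cell d → ι → ι → (V →L[ℝ] V)} {u u' : Cell d → ι → V}
    (h : ∀ γ α, u γ α = u' γ α) (hu : IsHarmonic K u) : IsHarmonic K u' := by
  have : u = u' := funext fun γ => funext fun α => h γ α
  exact this ▸ hu

/-- the increment field along `e`. -/
def incr (u : Cell d → ι → V) (e : Cell d) : Cell d → ι → V := fun γ α => u (γ + e) α - u γ α

/-- the increment field `u (· + e) − u` of a `K`-harmonic field is `K`-harmonic (shift minus identity). [folklore] -/
theorem IsHarmonic.incr {K : Cell d → ι → ι → (V →L[ℝ] V)} {u : Cell d → ι → V}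
    (hu : IsHarmonic K u) (e : Cell d) : IsHarmonic K (incr u e) :=
  (hu.shift e).sub hu

omit [InnerProductSpace ℝ V] in
/-- a field of bounded discrete gradient has BOUNDED increment fields: `‖incr u e γ α‖ ≤ C (‖e‖ + 1)`. [folklore] -/
theorem isBdd_incr_of_boundedGradient {u : Cell d → ι → V} (hu : BoundedGradient u) (e : Cell d) :
    IsBdd (incr u e) := by
  obtain ⟨C, hC⟩ := hu
  refine ⟨C * (‖e‖ + 1), fun γ α => ?_⟩
  have h := hC γ (γ + e) α α
  have hd : dist γ (γ + e) = ‖e‖ := by simp [dist_eq_norm]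
  simpa [incr, hd] using h

/-! ### «constant increments along every axis ⇒ affine» on `ℤᵈ` -/

/-- a function on `ℤᵈ` invariant under the `d` unit shifts is constant. -/
theorem eq_of_forall_shift {W : Type*} {f : Cell d → W}
    (h : ∀ (γ : Cell d) (j : Fin d), f (γ + Pi.single j 1) = f γ) : ∀ γ, f γ = f 0 := by
  -- integer multiples of one unit shift
  have hnat : ∀ (γ : Cell d) (j : Fin d) (n : ℕ), f (γ + Pi.single j (n : ℤ)) = f γ := by
    intro γ j n
    induction n with
    | zero => simp
    | succ n ih =>
      have : (Pi.single j ((n + 1 : ℕ) : ℤ) : Cell d) = Pi.single j (n : ℤ) + Pi.single j 1 := by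
        rw [← Pi.single_add (f := fun _ : Fin d => ℤ)]; push_cast; rfl
      rw [this, ← add_assoc, h, ih]
  have hint : ∀ (γ : Cell d) (j : Fin d) (z : ℤ), f (γ + Pi.single j z) = f γ := by
    intro γ j z
    obtain ⟨n, rfl | rfl⟩ := Int.eq_nat_or_neg z
    · exact hnat γ j n
    · have h1 := hnat (γ + Pi.single j (-(n : ℤ))) j n
      rw [add_assoc, ← Pi.single_add (f := fun _ : Fin d => ℤ)] at h1
      simpa using h1.symm
  -- finite sums of shifts
  have hsum : ∀ (s : Finset (Fin d)) (γ w : Cell d), f (γ + ∑ j ∈ s, Pi.single j (w j)) = f γ := by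
    intro s
    induction s using Finset.induction_on with
    | empty => intro γ w; simp
    | insert j s hj ih =>
      intro γ w
      rw [Finset.sum_insert hj, add_comm (Pi.single j (w j) : Cell d) _, ← add_assoc, hint, ih]
  intro γ
  have h0 := hsum Finset.univ 0 γ
  rw [Finset.univ_sum_single γ, zero_add] at h0
  exact h0

/-- directional sums along a single axis: `Σ_i (single j r) i • a i = r • a j`. -/
theorem sum_single_smul (j : Fin d) (r : ℤ) (a : Fin d → V) :
    (∑ i, ((Pi.single j r : Cell d) i : ℝ) • a i) = (r : ℝ) • a j := by
  classical
  simp [Pi.single_apply, Finset.sum_ite_eq', ite_smul]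

/-- a bounded arithmetic progression in a normed space has zero step. -/
theorem eq_zero_of_forall_norm_natCast_smul_add_le {x y : V} {C : ℝ} (h : ∀ n : ℕ, ‖(n : ℝ) • x + y‖ ≤ C) :
    x = 0 := by
  by_contra hx
  have hxpos : 0 < ‖x‖ := norm_pos_iff.mpr hx
  obtain ⟨n, hn⟩ := exists_nat_gt ((C + ‖y‖) / ‖x‖)
  have h1 : (n : ℝ) * ‖x‖ - ‖y‖ ≤ ‖(n : ℝ) • x + y‖ := by
    have := norm_sub_le_norm_add ((n : ℝ) • x) y
    have hns : ‖(n : ℝ) • x‖ = (n : ℝ) * ‖x‖ := by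
      rw [norm_smul, Real.norm_of_nonneg (Nat.cast_nonneg n)]
    -- ‖a‖ - ‖b‖ ≤ ‖a + b‖
    have h2 : ‖(n : ℝ) • x‖ - ‖y‖ ≤ ‖(n : ℝ) • x + y‖ := by
      have := norm_le_norm_add_norm_sub' ((n : ℝ) • x + y) y  -- placeholder, replaced below
      have h3 : ‖(n : ℝ) • x‖ ≤ ‖(n : ℝ) • x + y‖ + ‖y‖ := by
        simpa using norm_add_le ((n : ℝ) • x + y) (-y)
      linarith
    linarith [h2, hns]
  have h4 : (C + ‖y‖) / ‖x‖ * ‖x‖ = C + ‖y‖ := div_mul_cancel₀ _ hxpos.ne'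
  have h5 : (C + ‖y‖) < (n : ℝ) * ‖x‖ := by
    calc C + ‖y‖ = (C + ‖y‖) / ‖x‖ * ‖x‖ := h4.symm
      _ < (n : ℝ) * ‖x‖ := by exact mul_lt_mul_of_pos_right hn hxpos
  linarith [h n, h1, h5]

end Abstract

end Summit.AtomisticToContinuum.Crystallization.Theorems.ChartedZeroExcessLayeredLatticeLiouville

end
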